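import Mathlib
import Literature.Computability.AlgebraicComplexity.OrbitCoordinateRing
import Literature.Computability.AlgebraicComplexity.GCTObstructions
import Literature.Computability.Complexity.OccurrenceObstructionsBIP
import Summits.ValiantsHypothesis.ValiantsHypothesis.Theorems.ValuativeGCTValuativeFlipLinearEntryDeterminants
import Summits.ValiantsHypothesis.ValiantsHypothesis.Theorems.ValuativeGCTValuativeFlipNoSmallBodyTools

/-!
# No-small-body equations for `Δ(det_m)` — the core vanishing theorem

Crux `ValuativeGCT.ValuativeFlip` (stmt-ValiantsHypothesis-12624), wall-breaker axis D
("det-orbit-closure multiplicity bounds for `detCensus`", seat k3 gen 1/2).  Third file of the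
chain; the det-side theorem `K_m(λ*) = a_λ(δ[m])` for `|λ̄| ≤ m` and its crux-currency corollary
(no valuative flip at body `≤ m`, any centre) are in `ValuativeGCTValuativeFlipNoSmallBodyEquations`.

**Theorem (`nsb_eq_zero_of_forall_body_le`).**  Let `F ∈ ℂ[Sym^m ℂ^{m×m}]` be a polynomial in the
coefficients `c_d` (`d` the degree-`m` exponent vectors in the matrix variables), homogeneous in the
`c_d`, every monomial `∏ c_{dᵢ}` of which has BODY `Σᵢ (m - dᵢ(x_top)) ≤ m` (total degree of the
`x^{dᵢ}` away from the top variable).  If `F` vanishes on the orbit `GL_{m²} · det_m`, then `F = 0`.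

Proof.  Pick a monomial `s` of `F` with the fewest body factors `d ≠ x_top^m`, index its body
factors (with multiplicity) by a set `J` of slots `k = ⟨d_k, i⟩`, and form over the parameter ring
`ℂ[T_k : k ∈ J]` the test form `G = X_top^{m-b} ∏_{k ∈ J} (X_top^{a_k} + T_k x^{γ_k})`,
`a_k = m - d_k(top)`, `x^{γ_k} = x^{d_k} / X_top^{d_k(top)}`, `b = Σ a_k ≤ m`.  Every specialisation
`G_t` is an `m × m` linear-entry determinant (`nsb_testForm_mem_orbitClosure_detFormLex`), so
`F(G_t) = 0` for all `t`, hence `Q := F(coefficients of G) = 0` in `ℂ[T]`.  On the other hand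
`G = Σ_{A ⊆ J} T^A x^{e(A)}` (`nsb_testForm_expand`), so the coefficient of the square-free monomial
`T^J` in `Q` is `Σ_{s'} F_{s'} · N(s')`, where `N(s')` counts the ways of choosing, for each factor
slot of `s'`, a block `A ⊆ J` with `x^{e(A)}` equal to that factor, the blocks partitioning `J`
(`nsb_coeff_prod_sum_indicator`).  Blocks are empty exactly at the factors `x_top^m`, so a monomial
`s'` with `N(s') ≠ 0` has at most `#J` body factors, hence exactly `#J` by minimality, all its blocks
are singletons, and reading labels back (`e({k}) = d_k`) gives `s' = s` (`nsb_core_count`); and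
`N(s) ≥ 1` (diagonal blocks).  So the coefficient is `F_s · N(s) ≠ 0`, contradicting `Q = 0`.
Elementary throughout [folklore]; no trace identities (Procesi–Razmyslov) are needed.
-/

-- `Summit.ValiantsHypothesis.ValiantsHypothesis.…` is the tree's mandated single-conjunct layout (Sub = Summit).
set_option linter.dupNamespace false

namespace Summit.ValiantsHypothesis.ValiantsHypothesis.Theorems.ValuativeFlip

open MvPolynomial
open Literature.NumberTheory.DiophantineGeometry Literature.Computability.AlgebraicComplexity
open Literature.Computability.Complexity
open scoped BigOperators

set_option maxHeartbeats 800000 in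
/-- **No small-body test polynomial vanishes on `Δ(det_m)`.**  A polynomial `F` in the degree-`m`
coefficients, homogeneous in them, all of whose monomials have body
`Σ_d s(d) · (m - d(x_top)) ≤ m`, and which vanishes on `GL_{m²} · det_m`, is zero.  (The weight
vectors of weight `λ*` with `|λ̄| ≤ m` are such `F`, see `ValuativeGCTValuativeFlipNoSmallBodyEquations`.)
[folklore] -/
theorem nsb_eq_zero_of_forall_body_le {m : ℕ} [NeZero m] {δ : ℕ}
    (F : MvPolynomial (DegIdx (MatIdx m) m) ℂ) (hF : F.IsHomogeneous δ)
    (hbody : ∀ s ∈ F.support, ∑ d ∈ s.support, s d * (m - d.1 (topMatIdx m)) ≤ m)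
    (hvan : F ∈ orbitVanishingIdeal (detFormLex ℂ m) m) : F = 0 := by
  classical
  by_contra hF0
  -- the top variable and the top coordinate `x_top^m`
  set τ : MatIdx m := topMatIdx m with hτ
  have hdegτ : (Finsupp.single τ m : MatIdx m →₀ ℕ) ∈ degMonomials (MatIdx m) m :=
    mem_degMonomials_iff.mpr (Finsupp.degree_single τ m)
  set dτ : DegIdx (MatIdx m) m := ⟨Finsupp.single τ m, hdegτ⟩ with hdτ
  -- slots of a monomial: `K s` all factor slots, `J s` the body (non-top) slots
  obtain ⟨K, hK⟩ : ∃ K : (DegIdx (MatIdx m) m →₀ ℕ) → Finset (Σ _ : DegIdx (MatIdx m) m, ℕ),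
      K = fun s => s.support.sigma fun d => Finset.range (s d) := ⟨_, rfl⟩
  obtain ⟨J, hJ⟩ : ∃ J : (DegIdx (MatIdx m) m →₀ ℕ) → Finset (Σ _ : DegIdx (MatIdx m) m, ℕ),
      J = fun s => (K s).filter fun k => k.1 ≠ dτ := ⟨_, rfl⟩
  have hmemJ : ∀ s k, k ∈ J s ↔ k ∈ K s ∧ k.1 ≠ dτ := fun s k => by rw [hJ, Finset.mem_filter]
  -- a monomial of `F` with the fewest body factors
  have hne : F.support.Nonempty := support_nonempty.mpr hF0
  obtain ⟨s, hs, hmin⟩ := Finset.exists_min_image F.support (fun s => (J s).card) hne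
  -- block data of a slot
  obtain ⟨a, ha⟩ : ∃ a : (Σ _ : DegIdx (MatIdx m) m, ℕ) → ℕ, a = fun k => m - k.1.1 τ := ⟨_, rfl⟩
  obtain ⟨γ, hγ⟩ : ∃ γ : (Σ _ : DegIdx (MatIdx m) m, ℕ) → (MatIdx m →₀ ℕ),
      γ = fun k => k.1.1.erase τ := ⟨_, rfl⟩
  have hdegk : ∀ k : (Σ _ : DegIdx (MatIdx m) m, ℕ), k.1.1.degree = m :=
    fun k => mem_degMonomials_iff.mp k.1.2
  have hsplitk : ∀ k : (Σ _ : DegIdx (MatIdx m) m, ℕ), (γ k).degree + k.1.1 τ = m := fun k => by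
    have h := congrArg Finsupp.degree (Finsupp.erase_add_single τ k.1.1)
    rw [map_add, Finsupp.degree_single, hdegk] at h
    rw [hγ]
    exact h
  have hτle : ∀ k : (Σ _ : DegIdx (MatIdx m) m, ℕ), k.1.1 τ ≤ m := fun k => by
    have := hsplitk k; omega
  have hγdeg : ∀ k, (γ k).degree = a k := fun k => by
    have := hsplitk k; rw [ha]; dsimp only; omega
  have hγτ : ∀ k, γ k τ = 0 := fun k => by rw [hγ]; exact Finsupp.erase_same
  -- a slot whose factor is not `x_top^m` has positive block size
  have hτ_of_a : ∀ k : (Σ _ : DegIdx (MatIdx m) m, ℕ), a k = 0 → k.1 = dτ := by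
    intro k h0
    have hτm : k.1.1 τ = m := by
      have h1 := hτle k; rw [ha] at h0; dsimp only at h0; omega
    apply Subtype.ext
    have h0' : k.1.1.erase τ = 0 := by
      have h1 := hγdeg k
      rw [h0, hγ] at h1
      exact (Finsupp.degree_eq_zero_iff _).mp h1
    calc k.1.1 = k.1.1.erase τ + Finsupp.single τ (k.1.1 τ) := (Finsupp.erase_add_single τ _).symm
      _ = Finsupp.single τ m := by rw [h0', zero_add, hτm]
  have ha_dτ : ∀ k : (Σ _ : DegIdx (MatIdx m) m, ℕ), k.1 = dτ → a k = 0 := by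
    intro k hk
    rw [ha]; dsimp only; rw [hk, hdτ]; dsimp only
    rw [Finsupp.single_eq_same]; exact Nat.sub_self m
  have ha1 : ∀ k ∈ J s, 1 ≤ a k := by
    intro k hk
    rw [hmemJ] at hk
    rw [Nat.one_le_iff_ne_zero]
    exact fun h0 => hk.2 (hτ_of_a k h0)
  -- total body size of `s`
  have hb : ∑ k ∈ J s, a k = ∑ d ∈ s.support, s d * (m - d.1 τ) := by
    have h1 : ∑ k ∈ J s, a k = ∑ k ∈ K s, a k := by
      rw [hJ]
      exact Finset.sum_filter_of_ne fun k _ hne heq => hne (ha_dτ k heq)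
    rw [h1, hK]
    dsimp only
    rw [Finset.sum_sigma]
    refine Finset.sum_congr rfl fun d _ => ?_
    simp only [ha]
    rw [Finset.sum_const, Finset.card_range, smul_eq_mul]
  have hbm : ∑ k ∈ J s, a k ≤ m := hb ▸ hbody s hs
  -- the exponent vector of a set of blocks
  obtain ⟨e, he⟩ : ∃ e : Finset (Σ _ : DegIdx (MatIdx m) m, ℕ) → (MatIdx m →₀ ℕ),
      e = fun A => Finsupp.single τ (m - ∑ k ∈ A, a k) + ∑ k ∈ A, γ k := ⟨_, rfl⟩
  have he_empty : e ∅ = Finsupp.single τ m := by rw [he]; simp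
  have he_ne : ∀ A, A ⊆ J s → A ≠ ∅ → e A ≠ Finsupp.single τ m := by
    intro A hA hAne heq
    obtain ⟨k, hk⟩ := Finset.nonempty_iff_ne_empty.mpr hAne
    have hγk : γ k ≠ 0 := by
      intro h0
      have h1 := hγdeg k
      rw [h0, map_zero] at h1
      have h2 := ha1 k (hA hk)
      omega
    obtain ⟨v, hv⟩ : ∃ v, γ k v ≠ 0 := by
      by_contra hall
      push Not at hall
      exact hγk (Finsupp.ext hall)
    have hvτ : τ ≠ v := by
      intro hvt; rw [← hvt, hγτ] at hv; exact hv rfl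
    have h1 : (e A) v = 0 := by rw [heq, Finsupp.single_apply, if_neg hvτ]
    have h2 : γ k v ≤ (e A) v := by
      rw [he]
      dsimp only
      rw [Finsupp.add_apply, Finsupp.single_apply, if_neg hvτ, zero_add, Finsupp.finsetSum_apply]
      exact Finset.single_le_sum (f := fun k => γ k v) (fun _ _ => Nat.zero_le _) hk
    omega
  have he_single : ∀ k ∈ J s, e {k} = k.1.1 := by
    intro k hk
    rw [he]
    dsimp only
    rw [Finset.sum_singleton, Finset.sum_singleton]
    have h1 : m - a k = k.1.1 τ := by
      have := hτle k; rw [ha]; dsimp only; omega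
    rw [h1, hγ]
    exact Finsupp.single_add_erase τ k.1.1
  -- the generic test form over the parameter ring `ℂ[T_k]`
  set G : MvPolynomial (MatIdx m) (MvPolynomial (Σ _ : DegIdx (MatIdx m) m, ℕ) ℂ) :=
    X τ ^ (m - ∑ k ∈ J s, a k) *
      ∏ k ∈ J s, (X τ ^ (a k) +
        (X k : MvPolynomial (Σ _ : DegIdx (MatIdx m) m, ℕ) ℂ) • monomial (γ k) 1) with hG
  have hGexp : G = ∑ A ∈ (J s).powerset,
      monomial (e A) (∏ k ∈ A, (X k : MvPolynomial (Σ _ : DegIdx (MatIdx m) m, ℕ) ℂ)) := by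
    rw [hG, nsb_testForm_expand (J s) τ a γ _ hbm, he]
  have hcoeffG : ∀ e₀ : MatIdx m →₀ ℕ, coeff e₀ G =
      ∑ A ∈ (J s).powerset.filter (fun A => e A = e₀),
        ∏ k ∈ A, (X k : MvPolynomial (Σ _ : DegIdx (MatIdx m) m, ℕ) ℂ) := by
    intro e₀; rw [hGexp, nsb_coeff_sum_monomial]
  -- every specialisation is a point of `Δ(det_m)`, so `F` vanishes on the coefficients of `G`
  set Q : MvPolynomial (Σ _ : DegIdx (MatIdx m) m, ℕ) ℂ :=
    aeval (fun d : DegIdx (MatIdx m) m => coeff d.1 G) F with hQ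
  have hQ0 : Q = 0 := by
    apply MvPolynomial.funext
    intro t
    rw [map_zero]
    have hmem : MvPolynomial.map (eval t) G ∈ orbitClosure (detFormLex ℂ m) := by
      rw [hG, nsb_map_eval_testForm]
      exact nsb_testForm_mem_orbitClosure_detFormLex (J s) τ a γ t ha1 (fun k _ => hγdeg k) hbm
    have hvan' := orbitVanishingIdeal_le_of_mem_orbitClosure (m := m) hmem hvan
    have h1 := (mem_orbitVanishingIdeal_iff.mp hvan') 1
    simp only [map_one, Module.End.one_apply] at h1
    have hcomp : (MvPolynomial.aeval t).comp (aeval fun d : DegIdx (MatIdx m) m => coeff d.1 G) =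
        aeval fun d : DegIdx (MatIdx m) m => MvPolynomial.aeval t (coeff d.1 G) := comp_aeval _ _
    have h2 : eval t Q = aeval (fun d : DegIdx (MatIdx m) m => MvPolynomial.aeval t (coeff d.1 G)) F := by
      rw [hQ, ← hcomp]
      rfl
    have hfun : (fun d : DegIdx (MatIdx m) m => MvPolynomial.aeval t (coeff d.1 G)) =
        formCoeff m (MvPolynomial.map (eval t) G) := by
      funext d
      rw [formCoeff_apply, coeff_map]
      rfl
    rw [h2, hfun]
    exact h1
  -- admissible blocks of a slot, and the count `N`
  obtain ⟨𝒜, h𝒜⟩ : ∃ 𝒜 : (Σ _ : DegIdx (MatIdx m) m, ℕ) → Finset (Finset (Σ _ : DegIdx (MatIdx m) m, ℕ)),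
      𝒜 = fun k => (J s).powerset.filter fun A => e A = k.1.1 := ⟨_, rfl⟩
  have hmem𝒜 : ∀ k A, A ∈ 𝒜 k ↔ A ⊆ J s ∧ e A = k.1.1 := fun k A => by
    rw [h𝒜, Finset.mem_filter, Finset.mem_powerset]
  obtain ⟨N, hN⟩ : ∃ N : (DegIdx (MatIdx m) m →₀ ℕ) → ℕ,
      N = fun s' => (((K s').pi 𝒜).filter fun p =>
        ∑ k ∈ (K s').attach, ∑ j ∈ p k.1 k.2, (Finsupp.single j 1 : (Σ _ : DegIdx (MatIdx m) m, ℕ) →₀ ℕ) =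
          ∑ j ∈ J s, Finsupp.single j 1).card := ⟨_, rfl⟩
  -- the coefficient of the square-free parameter monomial `T^{J s}` in `Q`
  have hcoeffQ : coeff (∑ j ∈ J s, Finsupp.single j 1) Q = ∑ s' ∈ F.support, coeff s' F * (N s' : ℂ) := by
    rw [hQ, aeval_def, eval₂_eq, coeff_sum]
    refine Finset.sum_congr rfl fun s' _ => ?_
    rw [algebraMap_eq, coeff_C_mul]
    congr 1
    have hprod : ∏ d ∈ s'.support, coeff d.1 G ^ s' d = ∏ k ∈ K s', coeff k.1.1 G := by
      rw [hK]
      dsimp only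
      rw [Finset.prod_sigma]
      refine Finset.prod_congr rfl fun d _ => ?_
      dsimp only
      rw [Finset.prod_const, Finset.card_range]
    rw [hprod]
    simp only [hcoeffG]
    have h𝒜' : ∀ k : (Σ _ : DegIdx (MatIdx m) m, ℕ),
        (J s).powerset.filter (fun A => e A = k.1.1) = 𝒜 k := fun k => by rw [h𝒜]
    simp only [h𝒜']
    rw [nsb_coeff_prod_sum_indicator]
    simp only [hN]
    congr
  -- (1) only `s` itself is counted
  have hN0 : ∀ s' ∈ F.support, s' ≠ s → N s' = 0 := by
    intro s' hs' hne'
    rw [hN]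
    dsimp only
    rw [Finset.card_eq_zero, Finset.filter_eq_empty_iff]
    intro p hp hsum
    apply hne'
    rw [Finset.mem_pi] at hp
    -- the blocks as a total function
    set p' : (Σ _ : DegIdx (MatIdx m) m, ℕ) → Finset (Σ _ : DegIdx (MatIdx m) m, ℕ) :=
      fun k => if h : k ∈ K s' then p k h else ∅ with hp'
    have hp'K : ∀ k (h : k ∈ K s'), p' k = p k h := fun k h => by rw [hp']; exact dif_pos h
    have hsum' : ∑ k ∈ K s', ∑ j ∈ p' k, (Finsupp.single j 1 : (Σ _ : DegIdx (MatIdx m) m, ℕ) →₀ ℕ) =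
        ∑ j ∈ J s, Finsupp.single j 1 := by
      rw [← hsum, ← Finset.sum_attach (K s')]
      exact Finset.sum_congr rfl fun k _ => by rw [hp'K k.1 k.2]
    have hadm : ∀ k ∈ K s', p' k ⊆ J s ∧ e (p' k) = k.1.1 := fun k hk => by
      rw [hp'K k hk]; exact (hmem𝒜 k _).mp (hp k hk)
    have key := nsb_core_count Sigma.fst Sigma.fst dτ (J s) (K s') p'
      (fun k hk h0 => by
        have h := (hadm k hk).2
        rw [h0, he_empty] at h
        exact Subtype.ext h.symm)
      (fun k hk hkτ => by
        by_contra hne0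
        have h := (hadm k hk).2
        rw [hkτ, hdτ] at h
        exact he_ne _ (hadm k hk).1 hne0 h)
      (fun k hk j hj => by
        have h := (hadm k hk).2
        have hjJ : j ∈ J s := (hadm k hk).1 (by rw [hj]; exact Finset.mem_singleton_self j)
        rw [hj, he_single j hjJ] at h
        exact Subtype.ext h)
      hsum'
      (by rw [hJ] at hmin ⊢; exact hmin s' hs')
    simp only [hJ, hK] at key
    rw [nsb_sum_single_fst_slots, nsb_sum_single_fst_slots] at key
    refine nsb_eq_of_erase_eq_of_degree_eq dτ key ?_
    have hd1 : Finsupp.weight (1 : DegIdx (MatIdx m) m → ℕ) s' = δ := hF (mem_support_iff.mp hs')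
    have hd2 : Finsupp.weight (1 : DegIdx (MatIdx m) m → ℕ) s = δ := hF (mem_support_iff.mp hs)
    rw [Finsupp.degree_eq_weight_one]
    exact hd1.trans hd2.symm
  -- (2) `s` is counted at least once (diagonal blocks)
  have hNs : N s ≠ 0 := by
    rw [hN]
    dsimp only
    rw [Ne, Finset.card_eq_zero, ← Ne, ← Finset.nonempty_iff_ne_empty]
    refine ⟨fun k _ => if k.1 ≠ dτ then {k} else ∅, ?_⟩
    rw [Finset.mem_filter, Finset.mem_pi]
    refine ⟨fun k hk => ?_, ?_⟩
    · rw [hmem𝒜]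
      split_ifs with hkτ
      · have hkJ : k ∈ J s := (hmemJ s k).mpr ⟨hk, hkτ⟩
        exact ⟨Finset.singleton_subset_iff.mpr hkJ, he_single k hkJ⟩
      · push Not at hkτ
        refine ⟨Finset.empty_subset _, ?_⟩
        rw [he_empty, hkτ, hdτ]
    · have hatt := Finset.sum_attach (K s) (fun k => ∑ j ∈ (if k.1 ≠ dτ then ({k} : Finset _) else ∅),
        (Finsupp.single j 1 : (Σ _ : DegIdx (MatIdx m) m, ℕ) →₀ ℕ))
      dsimp only at hatt ⊢
      rw [hatt, nsb_sum_indicator_diag, hJ]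
  -- the contradiction
  have hcoeff : coeff (∑ j ∈ J s, Finsupp.single j 1) Q = coeff s F * (N s : ℂ) := by
    rw [hcoeffQ]
    refine Finset.sum_eq_single s (fun s' hs' hne' => ?_) (fun h => absurd hs h)
    rw [hN0 s' hs' hne', Nat.cast_zero, mul_zero]
  rw [hQ0, coeff_zero] at hcoeff
  exact mul_ne_zero (mem_support_iff.mp hs) (Nat.cast_ne_zero.mpr hNs) hcoeff.symm

end Summit.ValiantsHypothesis.ValiantsHypothesis.Theorems.ValuativeFlip
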